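import Summits.QuantumAdvantage.QuantumAdvantage.Theorems.CubicForrelationNearExactIsExactTwelveLevelSixEightPrep768
import Summits.QuantumAdvantage.QuantumAdvantage.Theorems.CubicForrelationNearExactIsExactTwelveLevelSixEight767
import Summits.QuantumAdvantage.QuantumAdvantage.Theorems.CubicForrelationNearExactIsExactTwelveClosed5964

/-!
# Crux `CubicForrelation.NearExactIsExact` (stmt-QuantumAdvantage-14043) — n = 12, level ≥ 6 with a level-`≥ 6` partner: the branch "`8 ∣ e` off
  the 9-flat" is dead for budget `Σ e² ≤ 768` WHENEVER `#L ≤ 31` (ℓ¹ argument of gens 18/20, boundary budget)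

Certificate seat `b2b-cforr-cert` (gen 23).  HONEST FRAMING: a lemma (standard axioms) about cubic Boolean pairs on 12 bits — `tw20_levelSix_eight_partner_false767`
VERBATIM at the boundary budget `B ≤ 768` with the extra hypothesis `#L ≤ 31` (which at `B = 768` fails only in configuration (δ₀): `E_off = 0`,
`#L = 32`); a brick for the value `29/32` at `n = 12` (HOME/b2b-cforr-cert-g23/PLAN-N12-928-L6.md).  Finite-slice statement, NOT summit progress.

`tw20_levelSix_eight_partner_false767`: `W_g = 64u''`, `e = u'' − (−1)^f`, `Z = {u'' even}` a 9-flat, `8 ∣ e` off `Z`, `W_f = 64·w_f`, `Σ e² ≤ B ≤ 767`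
do not coexist.  VERBATIM gen 18's `tw18_levelSix_eight_partner_false751` (preliminaries `tw20_levelSix_eight_prep767`: `λ` even on `Z`, flat ℓ¹
bound `Σ_y |W(σ·1_Z)(y)| ≤ 8192`; `ν = e − σ·1_Z ∈ 8ℤ` pointwise, `6·Σ|ν| ≤ B − 512`), with two constants moved: `Σ|ν| ≤ 40` (was `32`), so the
pointwise comparison becomes `3|ν̂(y)| ≤ 5|W(σ1_Z)(y)|` (`W(σ1_Z) + ν̂ ∈ 64ℤ`: either `|W(σ1_Z)| = |ν̂|`, or `|W(σ1_Z)| ≥ 64 − 40 = 24 ≥ (3/5)·40`),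
and the conclusion `3·32768 ≤ 5·8192` is still false.  (`ν = 0` gives `Φ = 15/16`, excluded by `tw15_isolation_ge_5964`.)

References: Ax (1964) / McEliece (1972); MacWilliams–Sloane (1977) Ch. 13–15; Carlet (2021) §5.2; O'Donnell (2014) §3.3.  Axioms: standard.
-/

set_option linter.dupNamespace false -- D-0017: single-problem summit ⇒ `QuantumAdvantage.QuantumAdvantage` by design

noncomputable section

namespace Summit.QuantumAdvantage.QuantumAdvantage.Theorems.CubicForrelation.NearExactIsExact

open Finset
open Literature.Computability.QuantumComplexity
open Literature.Computability.QuantumComplexity.BuzetChailloux (bxor zeroVec bxor_bxor_cancel_left bxor_zeroVec zeroVec_bxor bxor_comm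
  bxor_self)
open Literature.Computability.QuantumComplexity.DerivativeWalsh (W sum_W_sq)
open Literature.Computability.QuantumComplexity.Simon (twist_eq_one_or)

/-! ### The branch `8 ∣ e` off `Z` at budget `≤ B ≤ 767` with a level-`≥ 6` partner -/

/-- **Level `≥ 6` on both sides, `8 ∣ e` off the 9-flat, budget `Σ e² ≤ B ≤ 767`: impossible** (flat ℓ¹ bound versus the partner's
spectrum `W_f = 64(−1)^g − ê`). [this work] -/
theorem tw23_levelSix_eight_partner_false768 (B : ℤ) (hB : B ≤ 768) (f g : (Fin (6 + 6) → Bool) → Bool) (hf : IsDegLeFun 3 f) (hg : IsDegLeFun 3 g)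
    (u'' : (Fin (6 + 6) → Bool) → ℤ) (hu'' : ∀ x, W (fun y => signOf (g y)) x = (2 : ℝ) ^ 6 * (u'' x : ℝ))
    (wf : (Fin (6 + 6) → Bool) → ℤ) (hwf : ∀ y, W (fun x => signOf (f x)) y = (2 : ℝ) ^ 6 * (wf y : ℝ))
    (hlo : (7 / 8 : ℝ) < forrelation f g) (hhi : forrelation f g < 1)
    (hB_le : (∑ x, (u'' x - sZ (f x)) ^ 2 : ℤ) ≤ B)
    (V₀ : Finset (Fin (6 + 6) → Bool)) (xZ : Fin (6 + 6) → Bool) (h0 : zeroVec ∈ V₀)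
    (hadd : ∀ a ∈ V₀, ∀ b ∈ V₀, bxor a b ∈ V₀) (hcardV : #V₀ = 512)
    (hS : (univ.filter fun x : Fin (6 + 6) → Bool => ¬ Odd (u'' x)) = V₀.image (bxor xZ))
    (hoff8 : ∀ y, y ∉ (univ.filter fun x : Fin (6 + 6) → Bool => ¬ Odd (u'' x)) → (8 : ℤ) ∣ u'' y - sZ (f y))
    (hL31 : #((univ.filter fun x : Fin (6 + 6) → Bool => ¬ Odd (u'' x)).filter fun x =>
      Odd ((u'' x - sZ (f x) - sZ (decide ((u'' x - sZ (f x)) % 4 = 3))) / 4)) ≤ 31) : False := by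
  classical
  set u : (Fin (6 + 6) → Bool) → ℤ := fun x => 4 * u'' x with hudef
  have hu : ∀ x, W (fun y => signOf (g y)) x = (2 : ℝ) ^ 4 * (u x : ℝ) := by
    intro x; rw [hu'' x]; simp only [u]; push_cast; ring
  set e : (Fin (6 + 6) → Bool) → ℤ := fun x => u'' x - sZ (f x) with hedef
  change (∑ x, e x ^ 2 : ℤ) ≤ B at hB_le
  have hFe : ∀ y, u y - 4 * sZ (f y) = 4 * e y := fun y => by simp only [u, e]; ring
  set Z := univ.filter (fun x : Fin (6 + 6) → Bool => ¬ Odd (u'' x)) with hZdef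
  have hmemZ : ∀ x, x ∈ Z ↔ ¬ Odd (u'' x) := fun x => by simp [hZdef]
  change ∀ y, y ∉ Z → (8 : ℤ) ∣ e y at hoff8
  have heodd : ∀ x, x ∈ Z → Odd (e x) := by
    intro x hx
    have hev := Int.not_odd_iff_even.1 ((hmemZ x).1 hx)
    rcases tp_sZ_cases (f x) with hs | hs <;> simp only [e] <;> rw [hs]
    · exact Int.odd_sub.2 (iff_of_false (Int.not_odd_iff_even.2 hev) (by decide))
    · exact Int.odd_sub.2 (iff_of_false (Int.not_odd_iff_even.2 hev) (by decide))
  have hsq1 : ∀ x, x ∈ Z → 1 ≤ e x ^ 2 := by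
    intro x hx
    have h0 := Int.odd_iff.1 (heodd x hx)
    have : e x ≤ -1 ∨ 1 ≤ e x := by omega
    have := tp_sq_ge (k := 1) (by norm_num) this
    linarith
  have hsplit : (∑ x, e x ^ 2 : ℤ) = ∑ x ∈ Z, e x ^ 2 + ∑ x ∈ univ.filter (fun x => x ∉ Z), e x ^ 2 := by
    rw [← sum_filter_add_sum_filter_not univ (fun x => x ∈ Z)]
    congr 1
    exact sum_congr (by ext x; simp) fun _ _ => rfl
  have hpar : ∑ x, u'' x ^ 2 = 4096 := by
    have h := zms_sum_u_sq 2 g u (fun x => (hu x).trans (by norm_num))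
    have e : ∑ x, ((u x : ℝ)) ^ 2 = 16 * ∑ x, ((u'' x : ℝ)) ^ 2 := by
      rw [mul_sum]; exact sum_congr rfl fun x _ => by simp only [u]; push_cast; ring
    rw [e] at h
    norm_num at h
    have h' : ∑ x, ((u'' x : ℝ)) ^ 2 = 4096 := by linarith
    exact_mod_cast h'
  have hZcard : #Z = 512 := by
    rw [hS, card_image_of_injective _ (fun a b h => by simpa using congrArg (bxor xZ) h), hcardV]
  have hcardV9 : #V₀ = 2 ^ 9 := by rw [hcardV]; norm_num
  have hxZ : xZ ∈ Z := by rw [hS]; exact mem_image.2 ⟨zeroVec, h0, bxor_zeroVec xZ⟩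
  have hPV : ∀ x, x ∈ Z → ∀ a ∈ V₀, bxor x a ∈ Z := fun x hx a ha => fl1_coset_vadd hadd hS hx ha
  have hon_le : ∑ x ∈ Z, (e x ^ 2 - 1) ≤ B - 512 := by
    rw [sum_sub_distrib, sum_const, nsmul_eq_mul, mul_one, hZcard]
    have h3 : 0 ≤ ∑ x ∈ univ.filter (fun x => x ∉ Z), e x ^ 2 := sum_nonneg fun x _ => sq_nonneg _
    push_cast
    linarith
  set hb : (Fin (6 + 6) → Bool) → Bool := fun x => decide (e x % 4 = 3) with hhb
  set lam : (Fin (6 + 6) → Bool) → ℤ := fun x => (e x - sZ (hb x)) / 4 with hlam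
  have hdec : ∀ x, x ∈ Z → e x = sZ (hb x) + 4 * lam x := by
    intro x hx
    have h0 := Int.odd_iff.1 (heodd x hx)
    have hmod : e x % 4 = 1 ∨ e x % 4 = 3 := by omega
    have h4 : (4 : ℤ) ∣ e x - sZ (hb x) := by
      rcases hmod with h1 | h3
      · have hsz : sZ (hb x) = 1 := by simp [hb, h1, sZ]
        rw [hsz]; omega
      · have hsz : sZ (hb x) = -1 := by simp [hb, h3, sZ]
        rw [hsz]; omega
    have := Int.mul_ediv_cancel' h4
    simp only [lam]
    linarith
  set A : (Fin (6 + 6) → Bool) → ℝ := fun x => if x ∈ Z then ((sZ (hb x) : ℤ) : ℝ) else 0 with hA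
  -- gen 16 preliminaries (`λ` even on `Z`, flat ℓ¹ bound), packaged in `…TwelveLevelSixEightPrep767`
  obtain ⟨hlam_even', hl1'⟩ := tw23_levelSix_eight_prep768 B f g hf hg u'' hu'' hB_le V₀ xZ h0 hadd hcardV hS hoff8 hL31
  have hlam_even : ∀ x, x ∈ Z → Even (lam x) := fun x hx => hlam_even' x hx
  have hl1 : ∑ y, |W A y| ≤ 8192 := hl1'

  /- NEW ENDING (gen 18): the partner's spectrum is `64(−1)^g − ê`, so `64 ∣ ê`; split `e = σ·1_Z + ν` and compare ℓ¹ norms. -/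
  have hDnn : ∀ x ∈ Z, 0 ≤ e x ^ 2 - 1 := fun x hx => by linarith [hsq1 x hx]
  have hsplitZ : ∑ x ∈ Z, e x ^ 2 = 512 + ∑ x ∈ Z, (e x ^ 2 - 1) := by
    rw [sum_sub_distrib, sum_const, nsmul_eq_mul, mul_one, hZcard]; push_cast; ring
  -- the budget as an identity: `Σ e² = 8192 (1 − Φ)`
  have hbud := tw12_budget f g u hu
  have h16 : ∀ x, (u x - 4 * sZ (f x)) ^ 2 = 16 * e x ^ 2 := fun x => by rw [hFe]; ring
  have hBR : ((∑ x, e x ^ 2 : ℤ) : ℝ) = 8192 * (1 - forrelation f g) := by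
    have h' : ((∑ x, (u x - 4 * sZ (f x)) ^ 2 : ℤ) : ℝ) = 16 * ((∑ x, e x ^ 2 : ℤ) : ℝ) := by
      rw [sum_congr rfl fun x _ => h16 x, ← mul_sum]; push_cast; ring
    rw [h'] at hbud
    linarith
  -- `ν = e − σ·1_Z`
  set ν : (Fin (6 + 6) → Bool) → ℤ := fun x => if x ∈ Z then e x - sZ (hb x) else e x with hνdef
  have hνZ : ∀ x, x ∈ Z → ν x = 4 * lam x := by
    intro x hx; simp only [ν, if_pos hx]; have := hdec x hx; linarith
  have hνoff : ∀ x, x ∉ Z → ν x = e x := fun x hx => by simp only [ν, if_neg hx]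
  -- every nonzero `|ν(x)|` is `≥ 8` and costs `≥ 6|ν(x)|`
  have hν8 : ∀ x, ν x = 0 ∨ 8 ≤ |ν x| := by
    intro x
    by_cases hx : x ∈ Z
    · obtain ⟨k, hk⟩ := hlam_even x hx
      rw [hνZ x hx, hk]
      by_cases hk0 : k = 0
      · left; rw [hk0]; ring
      · right
        rw [abs_eq_max_neg]
        have : k ≤ -1 ∨ 1 ≤ k := by omega
        rcases this with h | h
        · exact le_max_of_le_right (by linarith)
        · exact le_max_of_le_left (by linarith)
    · obtain ⟨k, hk⟩ := hoff8 x hx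
      rw [hνoff x hx, hk]
      by_cases hk0 : k = 0
      · left; rw [hk0]; ring
      · right
        rw [abs_eq_max_neg]
        have : k ≤ -1 ∨ 1 ≤ k := by omega
        rcases this with h | h
        · exact le_max_of_le_right (by linarith)
        · exact le_max_of_le_left (by linarith)
  have hcostZ : ∀ x, x ∈ Z → 6 * |ν x| ≤ e x ^ 2 - 1 := by
    intro x hx
    have hd : e x = sZ (hb x) + ν x := by simp only [ν, if_pos hx]; ring
    rcases hν8 x with h0 | h8
    · rw [h0, abs_zero, mul_zero]; exact hDnn x hx
    · have hs1' : sZ (hb x) ^ 2 = 1 := by rcases tp_sZ_cases (hb x) with h | h <;> rw [h] <;> norm_num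
      rw [hd]
      rcases tp_sZ_cases (hb x) with hs | hs <;> rw [hs] <;> rw [hs] at hd
      · rcases le_or_gt 0 (ν x) with hp | hn
        · rw [abs_of_nonneg hp] at h8 ⊢; nlinarith
        · rw [abs_of_neg hn] at h8 ⊢; nlinarith
      · rcases le_or_gt 0 (ν x) with hp | hn
        · rw [abs_of_nonneg hp] at h8 ⊢; nlinarith
        · rw [abs_of_neg hn] at h8 ⊢; nlinarith
  have hcostOff : ∀ x, x ∉ Z → 6 * |ν x| ≤ e x ^ 2 := by
    intro x hx
    rw [hνoff x hx]
    rcases hν8 x with h0 | h8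
    · rw [hνoff x hx] at h0; rw [h0]; norm_num
    · rw [hνoff x hx] at h8
      rcases le_or_gt 0 (e x) with hp | hn
      · rw [abs_of_nonneg hp] at h8 ⊢; nlinarith
      · rw [abs_of_neg hn] at h8 ⊢; nlinarith
  -- total variation `6V ≤ B − 512 ≤ 255`
  have hV : 6 * ∑ x, |ν x| ≤ B - 512 := by
    have hsplitν : ∑ x, |ν x| = ∑ x ∈ Z, |ν x| + ∑ x ∈ univ.filter (fun x => x ∉ Z), |ν x| := by
      rw [← sum_filter_add_sum_filter_not univ (fun x => x ∈ Z)]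
      congr 1
      exact sum_congr (by ext x; simp) fun _ _ => rfl
    have h1 : 6 * ∑ x ∈ Z, |ν x| ≤ ∑ x ∈ Z, (e x ^ 2 - 1) := by
      rw [mul_sum]; exact sum_le_sum fun x hx => hcostZ x hx
    have h2 : 6 * ∑ x ∈ univ.filter (fun x => x ∉ Z), |ν x| ≤ ∑ x ∈ univ.filter (fun x => x ∉ Z), e x ^ 2 := by
      rw [mul_sum]; exact sum_le_sum fun x hx => hcostOff x (mem_filter.1 hx).2
    rw [hsplitν, mul_add]
    linarith [hsplit, hsplitZ]
  -- the partner's spectrum: `64 w_f(y) = 64 (−1)^{g(y)} − ê(y)`, hence `ê(y) ∈ 64ℤ`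
  have hinv : ∀ y, ∑ x, (u'' x : ℝ) * twist x y = 64 * signOf (g y) := by
    intro y
    have h := tz_inversion (fun y => signOf (g y)) y
    rw [sum_congr rfl fun x _ => by rw [hu'' x]] at h
    have h' : (2 : ℝ) ^ 6 * ∑ x, (u'' x : ℝ) * twist x y = 2 ^ (6 + 6) * signOf (g y) := by
      rw [mul_sum, ← h]; exact sum_congr rfl fun x _ => by ring
    have e64 : (2 : ℝ) ^ (6 + 6) = 2 ^ 6 * 64 := by norm_num
    rw [e64, mul_assoc] at h'
    exact mul_left_cancel₀ (by positivity) h'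
  have hê : ∀ y, ∑ x, (e x : ℝ) * twist x y = 64 * signOf (g y) - 64 * (wf y : ℝ) := by
    intro y
    have hW : W (fun x => signOf (f x)) y = ∑ x, ((u'' x : ℝ) - (e x : ℝ)) * twist x y := by
      unfold W
      refine sum_congr rfl fun x _ => ?_
      have : ((e x : ℤ) : ℝ) = (u'' x : ℝ) - signOf (f x) := by simp only [e]; push_cast; rw [tp_sZ_cast]
      rw [this]; ring
    rw [hwf y] at hW
    have : ∑ x, ((u'' x : ℝ) - (e x : ℝ)) * twist x y = ∑ x, (u'' x : ℝ) * twist x y - ∑ x, (e x : ℝ) * twist x y := by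
      rw [← sum_sub_distrib]; exact sum_congr rfl fun x _ => by ring
    rw [this, hinv y] at hW
    norm_num at hW ⊢
    linarith
  -- `ê = W A + ν̂`
  have hsplitê : ∀ y, ∑ x, (e x : ℝ) * twist x y = W A y + ∑ x, (ν x : ℝ) * twist x y := by
    intro y
    unfold W
    rw [← sum_add_distrib]
    refine sum_congr rfl fun x _ => ?_
    simp only [A, ν]
    split_ifs with hx
    · push_cast; ring
    · push_cast; ring
  -- `V ∈ 8ℤ` and `6V ≤ 255` give `V ≤ 40`
  have hν8dvd : ∀ x, (8 : ℤ) ∣ |ν x| := by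
    intro x
    rw [abs_eq_max_neg]
    have h8 : (8 : ℤ) ∣ ν x := by
      by_cases hx : x ∈ Z
      · obtain ⟨k, hk⟩ := hlam_even x hx
        exact ⟨k, by rw [hνZ x hx, hk]; ring⟩
      · obtain ⟨k, hk⟩ := hoff8 x hx
        exact ⟨k, by rw [hνoff x hx]; exact hk⟩
    rcases le_total 0 (ν x) with h | h
    · rw [max_eq_left (by linarith)]; exact h8
    · rw [max_eq_right (by linarith)]; exact (dvd_neg).2 h8
  have hV40 : (∑ x, |ν x| : ℤ) ≤ 40 := by
    have h6 : 6 * ∑ x, |ν x| ≤ 256 := by linarith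
    have h8 : (8 : ℤ) ∣ ∑ x, |ν x| := dvd_sum fun x _ => hν8dvd x
    omega
  have hνhat_le : ∀ y, |∑ x, (ν x : ℝ) * twist x y| ≤ 40 := by
    intro y
    calc |∑ x, (ν x : ℝ) * twist x y| ≤ ∑ x, |(ν x : ℝ) * twist x y| := abs_sum_le_sum_abs _ _
      _ = ∑ x, |(ν x : ℝ)| := sum_congr rfl fun x _ => by
          rw [abs_mul]; rcases twist_eq_one_or x y with h | h <;> rw [h] <;> simp
      _ ≤ 40 := by
          have : ((∑ x, |ν x| : ℤ) : ℝ) ≤ 40 := by exact_mod_cast hV40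
          push_cast at this; exact this
  -- pointwise `3|ν̂ y| ≤ 5|W A y|`: `W A y + ν̂ y ∈ 64ℤ` and `|ν̂ y| ≤ 40` (`|W A y| = |ν̂ y|`, or `|W A y| ≥ 64 − 40 = 24 ≥ (3/5)·40`)
  have hptwise : ∀ y, 3 * |∑ x, (ν x : ℝ) * twist x y| ≤ 5 * |W A y| := by
    intro y
    have hsum : W A y + ∑ x, (ν x : ℝ) * twist x y = 64 * (signOf (g y) - (wf y : ℝ)) := by
      rw [← hsplitê, hê]; ring
    have hsg : signOf (g y) = 1 ∨ signOf (g y) = -1 := by cases g y <;> simp [signOf]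
    obtain ⟨m, hm⟩ : ∃ m : ℤ, (signOf (g y) - (wf y : ℝ)) = (m : ℝ) := by
      rcases hsg with h | h
      · exact ⟨1 - wf y, by rw [h]; push_cast; ring⟩
      · exact ⟨-1 - wf y, by rw [h]; push_cast; ring⟩
    rw [hm] at hsum
    by_cases hm0 : m = 0
    · rw [hm0] at hsum; norm_num at hsum
      rw [show W A y = -(∑ x, (ν x : ℝ) * twist x y) by linarith, abs_neg]
      linarith [abs_nonneg (∑ x, (ν x : ℝ) * twist x y)]
    · have hm1 : (1 : ℝ) ≤ |(m : ℝ)| := by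
        rw [← Int.cast_abs]; exact_mod_cast Int.one_le_abs hm0
      have h64 : 64 ≤ |W A y + ∑ x, (ν x : ℝ) * twist x y| := by
        rw [hsum, abs_mul]; norm_num; linarith
      have := abs_add_le (W A y) (∑ x, (ν x : ℝ) * twist x y)
      linarith [hνhat_le y]
  -- case `ν = 0`: `Σ e² = 512`, `Φ = 15/16`, isolation
  by_cases hν0 : ∀ x, ν x = 0
  · have heZ : ∀ x, x ∈ Z → e x ^ 2 = 1 := by
      intro x hx
      have : e x = sZ (hb x) := by have h := hν0 x; simp only [ν, if_pos hx] at h; linarith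
      rw [this]; rcases tp_sZ_cases (hb x) with h | h <;> rw [h] <;> norm_num
    have heO : ∀ x, x ∉ Z → e x ^ 2 = 0 := by
      intro x hx; have h := hν0 x; simp only [ν, if_neg hx] at h; rw [h]; ring
    have hB512 : (∑ x, e x ^ 2 : ℤ) = 512 := by
      rw [hsplit, sum_congr rfl heZ, sum_const, hZcard, sum_eq_zero fun x hx => heO x (mem_filter.1 hx).2]
      norm_num
    have hΦ : forrelation f g = 15 / 16 := by
      have : ((512 : ℤ) : ℝ) = 8192 * (1 - forrelation f g) := by rw [← hB512]; exact hBR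
      push_cast at this; linarith
    have h1 := tw15_isolation_ge_5964 f g hf hg (by rw [hΦ]; norm_num)
    linarith
  · push Not at hν0
    obtain ⟨x₀, hx₀⟩ := hν0
    -- `Σ_y |ν̂|` is large: `Σ ν̂² = 4096 Σ ν²`, `|ν̂| ≤ 39`, `Σ ν² ≥ 8·Σ|ν| ≥ 64`... we use `Σ ν̂² ≥ 4096·8·Σ|ν|` and `|ν̂| ≤ Σ|ν|`
    set Vr : ℝ := ∑ x, |(ν x : ℝ)| with hVr
    have hVpos : 0 < Vr := by
      have h8 : (8 : ℝ) ≤ |(ν x₀ : ℝ)| := by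
        rcases hν8 x₀ with h | h
        · exact absurd h hx₀
        · rw [← Int.cast_abs]; exact_mod_cast h
      have : |(ν x₀ : ℝ)| ≤ Vr := single_le_sum (f := fun x => |(ν x : ℝ)|) (fun x _ => abs_nonneg _) (mem_univ x₀)
      linarith
    have hνsq : 8 * Vr ≤ ∑ x, ((ν x : ℝ)) ^ 2 := by
      rw [hVr, mul_sum]
      refine sum_le_sum fun x _ => ?_
      rcases hν8 x with h | h
      · rw [h]; simp
      · have h8 : (8 : ℝ) ≤ |(ν x : ℝ)| := by rw [← Int.cast_abs]; exact_mod_cast h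
        have : ((ν x : ℝ)) ^ 2 = |(ν x : ℝ)| * |(ν x : ℝ)| := by rw [abs_mul_abs_self]; ring
        rw [this]; nlinarith [abs_nonneg ((ν x : ℝ))]
    have hpars : ∑ y, (∑ x, (ν x : ℝ) * twist x y) ^ 2 = 4096 * ∑ x, ((ν x : ℝ)) ^ 2 := by
      have h := sum_W_sq (n := 6 + 6) (fun x => (ν x : ℝ))
      unfold W at h
      rw [h]; norm_num
    have hbound : ∀ y, |∑ x, (ν x : ℝ) * twist x y| ≤ Vr := by
      intro y
      calc |∑ x, (ν x : ℝ) * twist x y| ≤ ∑ x, |(ν x : ℝ) * twist x y| := abs_sum_le_sum_abs _ _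
        _ = Vr := sum_congr rfl fun x _ => by
            rw [abs_mul]; rcases twist_eq_one_or x y with h | h <;> rw [h] <;> simp
    -- `Vr · Σ|ν̂| ≥ Σ ν̂² ≥ 4096 · 8 · Vr`
    have hl1ν : 32768 ≤ ∑ y, |∑ x, (ν x : ℝ) * twist x y| := by
      have h1 : ∑ y, (∑ x, (ν x : ℝ) * twist x y) ^ 2 ≤ Vr * ∑ y, |∑ x, (ν x : ℝ) * twist x y| := by
        rw [mul_sum]
        refine sum_le_sum fun y _ => ?_
        have hsq : (∑ x, (ν x : ℝ) * twist x y) ^ 2 = |∑ x, (ν x : ℝ) * twist x y| * |∑ x, (ν x : ℝ) * twist x y| := by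
          rw [abs_mul_abs_self]; ring
        rw [hsq]
        exact mul_le_mul_of_nonneg_right (hbound y) (abs_nonneg _)
      rw [hpars] at h1
      by_contra hlt
      push Not at hlt
      nlinarith [hνsq, hVpos]
    have hge : 3 * ∑ y, |∑ x, (ν x : ℝ) * twist x y| ≤ 5 * ∑ y, |W A y| := by
      rw [mul_sum, mul_sum]; exact sum_le_sum fun y _ => hptwise y
    linarith

end Summit.QuantumAdvantage.QuantumAdvantage.Theorems.CubicForrelation.NearExactIsExact

end
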